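import Literature.Analysis.FluidPDE.PlanarLogPotential
import Literature.Analysis.FluidPDE.BiotSavart2DSymmetry
import Literature.Analysis.FluidPDE.GaussianWeightedSpace
import HarnessLib

/-!
# Gaussian-weighted `L²` bounds for the planar Biot–Savart velocity and the logarithmic potential

Analysis/FluidPDE file (all results proved, no definitions, no named facts). For a continuous
compactly supported vorticity `g` on `ℝ²`, its Biot–Savart velocity `v = K_{2D} ∗ g`
(`biotSavart2D g`) and its logarithmic potential `ψ = N ∗ g`
(`fun x => ∫ y, g y * ((2π)⁻¹ * log ‖x − y‖)`), and for a weight `0 ≤ W ≤ K e^{−β|x|²}`, we prove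
the weighted bounds

* `∫ W |v|² ≤ C ∫ e^{c|y|²} g(y)² dy`,
* `∫ W ψ²  ≤ C ∫ e^{c|y|²} g(y)² dy`,

with `C = C(K, β, c)` independent of `g` (`c > 0` arbitrary). Proof: the pointwise bounds
`|v(x)| ≤ (2π)⁻¹ ∫ |g(y)|/|x−y| dy`, `|ψ(x)| ≤ (2π)⁻¹ ∫ |g(y)| (|x−y|⁻¹ + |x−y|) dy`, Cauchy–Schwarz
against the Gaussian `e^{∓c|y|²}`, the uniform bound `sup_x ∫ V(y)/|x−y| dy ≤ (sup V) ∫_{|z|<1}|z|⁻¹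
+ ∫ V` for bounded integrable `V ≥ 0`, and Tonelli. These are the elementary weighted estimates
behind the compactness/boundedness of `w ↦ K_{2D} ∗ w` from Gaussian-weighted `L²` used in the
stability theory of the Burgers/Lamb–Oseen vortex (Gallay–Wayne 2005, Maekawa 2009).

## References

* Y. Maekawa, *Existence of asymmetric Burgers vortices and their asymptotic behavior at large
  circulations*, Math. Models Methods Appl. Sci. 19 (2009), §1 (the operator `Λ`, (1.20)–(1.22)).
  [Maekawa2009b]
* Th. Gallay, C. E. Wayne, *Global stability of vortex solutions of the two-dimensional
  Navier–Stokes equation*, Comm. Math. Phys. 255 (2005), Lemma 2.1 / Appendix (Biot–Savart bounds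
  in weighted spaces). [GallayWayne2005]
-/

noncomputable section

open Set Function Filter MeasureTheory Metric Real
open scoped InnerProductSpace RealInnerProductSpace Topology

namespace Literature.Analysis.FluidPDE

/-! ### Gaussians on `ℝ²` -/

/-- `e^{−β|x|²}` is integrable on `ℝ²` for `β > 0` (it is `(π/β) G_λ` with `λ = 1 − 4β`).
[folklore] -/
theorem integrable_exp_neg_mul_norm_sq_two {β : ℝ} (hβ : 0 < β) :
    Integrable fun x : EuclideanSpace ℝ (Fin 2) => Real.exp (-(β * ‖x‖ ^ 2)) := by
  have h := (integrable_gaussWeightLam (lam := 1 - 4 * β) (by linarith)).const_mul (Real.pi / β)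
  refine h.congr (Eventually.of_forall fun x => ?_)
  simp only [gaussWeightLam]
  have hπ : Real.pi ≠ 0 := Real.pi_pos.ne'
  have hb : β ≠ 0 := hβ.ne'
  rw [show (1 - (1 - 4 * β)) / 4 * ‖x‖ ^ 2 = β * ‖x‖ ^ 2 by ring]
  field_simp
  ring

/-- `t e^{−β t} ≤ 2β⁻¹ e^{−β t/2}` (`β > 0`, all real `t`). [folklore] -/
theorem mul_exp_neg_mul_le_exp_half {β : ℝ} (hβ : 0 < β) (t : ℝ) :
    t * Real.exp (-(β * t)) ≤ (2 / β) * Real.exp (-(β * t / 2)) := by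
  have h1 : β * t / 2 + 1 ≤ Real.exp (β * t / 2) := Real.add_one_le_exp _
  have h2 : t ≤ (2 / β) * Real.exp (β * t / 2) := by
    rw [div_mul_eq_mul_div, le_div_iff₀ hβ]
    nlinarith
  calc t * Real.exp (-(β * t)) ≤ (2 / β) * Real.exp (β * t / 2) * Real.exp (-(β * t)) := by
        gcongr
    _ = (2 / β) * Real.exp (-(β * t / 2)) := by
        rw [mul_assoc, ← Real.exp_add]; congr 2; ring

/-- `|x|² e^{−β|x|²}` is integrable on `ℝ²` for `β > 0`. [folklore] -/
theorem integrable_norm_sq_mul_exp_neg_mul_norm_sq_two {β : ℝ} (hβ : 0 < β) :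
    Integrable fun x : EuclideanSpace ℝ (Fin 2) => ‖x‖ ^ 2 * Real.exp (-(β * ‖x‖ ^ 2)) := by
  have h := (integrable_exp_neg_mul_norm_sq_two (half_pos hβ)).const_mul (2 / β)
  refine h.mono' (by fun_prop) (Eventually.of_forall fun x => ?_)
  rw [Real.norm_of_nonneg (by positivity)]
  have := mul_exp_neg_mul_le_exp_half hβ (‖x‖ ^ 2)
  convert this using 3; ring

/-! ### The inverse-norm potential of a bounded integrable density -/

/-- **Uniform bound on `∫ V(y)/|x−y| dy`**: for `0 ≤ V ≤ K` integrable,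
`∫ V(y) |x−y|⁻¹ dy ≤ K ∫_{|z|<1} |z|⁻¹ dz + ∫ V` for every `x`, and the integrand is integrable.
[folklore] -/
theorem integral_mul_inv_norm_sub_le {V : EuclideanSpace ℝ (Fin 2) → ℝ} {K : ℝ}
    (hVi : Integrable V) (h0 : ∀ y, 0 ≤ V y) (hK : ∀ y, V y ≤ K) (x : EuclideanSpace ℝ (Fin 2)) :
    Integrable (fun y => V y * ‖x - y‖⁻¹) ∧
      ∫ y, V y * ‖x - y‖⁻¹ ≤
        K * (∫ z, indicator (ball (0 : EuclideanSpace ℝ (Fin 2)) 1) (fun z => ‖z‖⁻¹) z) +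
          ∫ y, V y := by
  set m : EuclideanSpace ℝ (Fin 2) → ℝ := fun y =>
    K * indicator (ball (0 : EuclideanSpace ℝ (Fin 2)) 1) (fun z => ‖z‖⁻¹) (x - y) + V y with hm
  have hmi : Integrable m :=
    ((integrable_indicator_inv_norm.comp_sub_left x).const_mul K).add hVi
  have hle : ∀ y, V y * ‖x - y‖⁻¹ ≤ m y := by
    intro y
    simp only [hm]
    by_cases hxy : ‖x - y‖ < 1
    · rw [indicator_of_mem (mem_ball_zero_iff.2 hxy)]
      have : V y * ‖x - y‖⁻¹ ≤ K * ‖x - y‖⁻¹ := by gcongr; exact hK y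
      linarith [h0 y]
    · have h2 : ‖x - y‖⁻¹ ≤ 1 := inv_le_one_of_one_le₀ (not_lt.1 hxy)
      rw [indicator_of_notMem (by rwa [mem_ball_zero_iff]), mul_zero, zero_add]
      calc V y * ‖x - y‖⁻¹ ≤ V y * 1 := by gcongr; exact h0 y
        _ = V y := mul_one _
  have hmeas : AEStronglyMeasurable (fun y => V y * ‖x - y‖⁻¹) volume :=
    hVi.aestronglyMeasurable.mul
      ((measurable_const.sub measurable_id).norm.inv).aestronglyMeasurable
  have hint : Integrable (fun y => V y * ‖x - y‖⁻¹) := by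
    refine hmi.mono' hmeas (Eventually.of_forall fun y => ?_)
    rw [Real.norm_of_nonneg (mul_nonneg (h0 y) (inv_nonneg.2 (norm_nonneg _)))]
    exact hle y
  refine ⟨hint, ?_⟩
  calc ∫ y, V y * ‖x - y‖⁻¹ ≤ ∫ y, m y := integral_mono hint hmi hle
    _ = K * (∫ z, indicator (ball (0 : EuclideanSpace ℝ (Fin 2)) 1) (fun z => ‖z‖⁻¹) z) +
          ∫ y, V y := by
        simp only [hm]
        rw [integral_add ((integrable_indicator_inv_norm.comp_sub_left x).const_mul K) hVi,
          integral_const_mul,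
          integral_sub_left_eq_self (indicator (ball (0 : EuclideanSpace ℝ (Fin 2)) 1)
            fun z => ‖z‖⁻¹) volume x]

/-- The same bound with the roles of the variables exchanged: `∫ V(x) |x−y|⁻¹ dx`. [folklore] -/
theorem integral_mul_inv_norm_sub_le' {V : EuclideanSpace ℝ (Fin 2) → ℝ} {K : ℝ}
    (hVi : Integrable V) (h0 : ∀ y, 0 ≤ V y) (hK : ∀ y, V y ≤ K) (y : EuclideanSpace ℝ (Fin 2)) :
    Integrable (fun x => V x * ‖x - y‖⁻¹) ∧
      ∫ x, V x * ‖x - y‖⁻¹ ≤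
        K * (∫ z, indicator (ball (0 : EuclideanSpace ℝ (Fin 2)) 1) (fun z => ‖z‖⁻¹) z) +
          ∫ x, V x := by
  have h := integral_mul_inv_norm_sub_le hVi h0 hK y
  simp_rw [norm_sub_rev y] at h
  exact h

/-- The constant `∫_{|z|<1} |z|⁻¹ dz` is nonnegative. [folklore] -/
theorem integral_indicator_inv_norm_nonneg :
    0 ≤ ∫ z, indicator (ball (0 : EuclideanSpace ℝ (Fin 2)) 1) (fun z => ‖z‖⁻¹) z :=
  integral_nonneg indicator_inv_norm_nonneg

/-! ### Cauchy–Schwarz -/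

/-- Cauchy–Schwarz, squared form: `(∫ f g)² ≤ (∫ f²)(∫ g²)` for non-negative `f, g ∈ L²` (private
copy of the assembled form in `Literature.MathematicalPhysics.QuantumManyBody`, kept here to keep the
import closure inside Analysis/FluidPDE). [folklore] -/
private theorem sq_integral_mul_le_of_memLp_two {α : Type*} {m : MeasurableSpace α} {μ : Measure α}
    {f g : α → ℝ} (hf0 : 0 ≤ᵐ[μ] f) (hg0 : 0 ≤ᵐ[μ] g) (hf : MemLp f 2 μ) (hg : MemLp g 2 μ) :
    (∫ a, f a * g a ∂μ) ^ 2 ≤ (∫ a, f a ^ 2 ∂μ) * ∫ a, g a ^ 2 ∂μ := by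
  have h := integral_mul_le_Lp_mul_Lq_of_nonneg Real.HolderConjugate.two_two hf0 hg0
    (by rwa [ENNReal.ofReal_ofNat]) (by rwa [ENNReal.ofReal_ofNat])
  simp only [Real.rpow_two] at h
  have hA : 0 ≤ ∫ a, f a ^ 2 ∂μ := integral_nonneg fun a => sq_nonneg _
  have hB : 0 ≤ ∫ a, g a ^ 2 ∂μ := integral_nonneg fun a => sq_nonneg _
  have hI : 0 ≤ ∫ a, f a * g a ∂μ :=
    integral_nonneg_of_ae (by filter_upwards [hf0, hg0] with a ha hb using mul_nonneg ha hb)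
  calc (∫ a, f a * g a ∂μ) ^ 2
      ≤ ((∫ a, f a ^ 2 ∂μ) ^ (1 / 2 : ℝ) * (∫ a, g a ^ 2 ∂μ) ^ (1 / 2 : ℝ)) ^ 2 :=
        pow_le_pow_left₀ hI h 2
    _ = (∫ a, f a ^ 2 ∂μ) * ∫ a, g a ^ 2 ∂μ := by
        rw [mul_pow, ← Real.rpow_natCast ((∫ a, f a ^ 2 ∂μ) ^ (1 / 2 : ℝ)),
          ← Real.rpow_natCast ((∫ a, g a ^ 2 ∂μ) ^ (1 / 2 : ℝ)), ← Real.rpow_mul hA,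
          ← Real.rpow_mul hB]
        norm_num

/-- **Weighted Cauchy–Schwarz**: for non-negative integrable measurable `A, B`,
`(∫ √(A B))² ≤ (∫ A)(∫ B)`. [folklore] -/
theorem sq_integral_sqrt_mul_le {α : Type*} {m : MeasurableSpace α} {μ : Measure α}
    {A B : α → ℝ} (hA0 : ∀ a, 0 ≤ A a) (hB0 : ∀ a, 0 ≤ B a) (hAm : Measurable A)
    (hBm : Measurable B) (hA : Integrable A μ) (hB : Integrable B μ) :
    (∫ a, Real.sqrt (A a * B a) ∂μ) ^ 2 ≤ (∫ a, A a ∂μ) * ∫ a, B a ∂μ := by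
  have h := sq_integral_mul_le_of_memLp_two (μ := μ) (f := fun a => Real.sqrt (A a))
    (g := fun a => Real.sqrt (B a))
    (Eventually.of_forall fun a => Real.sqrt_nonneg _)
    (Eventually.of_forall fun a => Real.sqrt_nonneg _)
    ((memLp_two_iff_integrable_sq hAm.sqrt.aestronglyMeasurable).2
      (hA.congr (Eventually.of_forall fun a => (Real.sq_sqrt (hA0 a)).symm)))
    ((memLp_two_iff_integrable_sq hBm.sqrt.aestronglyMeasurable).2
      (hB.congr (Eventually.of_forall fun a => (Real.sq_sqrt (hB0 a)).symm)))
  simp only [Real.sq_sqrt (hA0 _), Real.sq_sqrt (hB0 _)] at h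
  simpa only [Real.sqrt_mul (hA0 _)] using h

/-! ### Pointwise bounds on the Biot–Savart velocity and the logarithmic potential -/

/-- `|v(x)| ≤ (2π)⁻¹ ∫ |g(y)| |x−y|⁻¹ dy` (both sides read as Bochner integrals). [folklore] -/
theorem norm_biotSavart2D_le_integral (g : EuclideanSpace ℝ (Fin 2) → ℝ)
    (x : EuclideanSpace ℝ (Fin 2)) :
    ‖biotSavart2D g x‖ ≤ (2 * Real.pi)⁻¹ * ∫ y, |g y| * ‖x - y‖⁻¹ := by
  unfold biotSavart2D
  refine (norm_integral_le_integral_norm _).trans (le_of_eq ?_)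
  rw [← integral_const_mul]
  refine integral_congr_ae (Eventually.of_forall fun y => ?_)
  simp only [norm_smul, Real.norm_eq_abs, norm_biotSavartKernel2D]
  ring

/-- `|ψ(x)| ≤ (2π)⁻¹ (∫ |g(y)| |x−y|⁻¹ dy + |x| ∫|g| + ∫ |y||g(y)| dy)` for a continuous compactly
supported vorticity (`|log r| ≤ r⁻¹ + r`, `|x − y| ≤ |x| + |y|`). [folklore] -/
theorem abs_logPotential_le_integral {g : EuclideanSpace ℝ (Fin 2) → ℝ} (hg : Continuous g)
    (hgc : HasCompactSupport g) (x : EuclideanSpace ℝ (Fin 2)) :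
    |∫ y, g y * ((2 * Real.pi)⁻¹ * Real.log ‖x - y‖)| ≤
      (2 * Real.pi)⁻¹ * ((∫ y, |g y| * ‖x - y‖⁻¹) + ‖x‖ * (∫ y, |g y|) + ∫ y, ‖y‖ * |g y|) := by
  obtain ⟨A, hA⟩ := hg.bounded_above_of_compact_support hgc
  have hA' : ∀ y, |g y| ≤ A := fun y => by simpa [Real.norm_eq_abs] using hA y
  have hgi : Integrable g := hg.integrable_of_hasCompactSupport hgc
  have h1 := (integral_mul_inv_norm_sub_le hgi.abs (fun y => abs_nonneg _) hA' x).1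
  have h2 : Integrable fun y => |g y| * ‖x - y‖ :=
    ((continuous_abs.comp hg).mul (continuous_const.sub continuous_id).norm)
      |>.integrable_of_hasCompactSupport (hgc.abs.mul_right)
  have h3 : Integrable fun y => ‖y‖ * |g y| :=
    (continuous_norm.mul (continuous_abs.comp hg)).integrable_of_hasCompactSupport
      (hgc.abs.mul_left)
  have hπ : 0 < (2 * Real.pi)⁻¹ := by positivity
  calc |∫ y, g y * ((2 * Real.pi)⁻¹ * Real.log ‖x - y‖)|
      = ‖∫ y, g y * ((2 * Real.pi)⁻¹ * Real.log ‖x - y‖)‖ := (Real.norm_eq_abs _).symm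
    _ ≤ ∫ y, ‖g y * ((2 * Real.pi)⁻¹ * Real.log ‖x - y‖)‖ := norm_integral_le_integral_norm _
    _ ≤ ∫ y, (2 * Real.pi)⁻¹ * (|g y| * ‖x - y‖⁻¹ + |g y| * ‖x - y‖) := by
        refine integral_mono_of_nonneg (Eventually.of_forall fun y => norm_nonneg _)
          ((h1.add h2).const_mul _) (Eventually.of_forall fun y => ?_)
        simp only [norm_mul, Real.norm_eq_abs, abs_of_pos hπ]
        rw [mul_left_comm, ← mul_add]
        refine mul_le_mul_of_nonneg_left (mul_le_mul_of_nonneg_left ?_ (abs_nonneg _)) hπ.le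
        rcases (norm_nonneg (x - y)).eq_or_lt with h0 | h0
        · rw [← h0]; simp
        · exact abs_log_le_inv_add_self h0
    _ = (2 * Real.pi)⁻¹ * ((∫ y, |g y| * ‖x - y‖⁻¹) + ∫ y, |g y| * ‖x - y‖) := by
        rw [integral_const_mul, integral_add h1 h2]
    _ ≤ (2 * Real.pi)⁻¹ * ((∫ y, |g y| * ‖x - y‖⁻¹) + ‖x‖ * (∫ y, |g y|) + ∫ y, ‖y‖ * |g y|) := by
        rw [add_assoc]
        gcongr
        rw [← integral_const_mul, ← integral_add (hgi.abs.const_mul _) h3]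
        refine integral_mono h2 ((hgi.abs.const_mul _).add h3) fun y => ?_
        have := norm_sub_le x y
        have h0 : 0 ≤ |g y| := abs_nonneg _
        nlinarith

/-- **Pointwise Cauchy–Schwarz against a Gaussian** (`c > 0`):
`(∫ |g(y)| |x−y|⁻¹ dy)² ≤ (∫ e^{−c|y|²} |x−y|⁻¹ dy) · ∫ e^{c|y|²} g(y)² |x−y|⁻¹ dy`. [folklore] -/
theorem sq_integral_abs_mul_inv_norm_le {g : EuclideanSpace ℝ (Fin 2) → ℝ} (hg : Continuous g)
    (hgc : HasCompactSupport g) {c : ℝ} (hc : 0 < c) (x : EuclideanSpace ℝ (Fin 2)) :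
    (∫ y, |g y| * ‖x - y‖⁻¹) ^ 2 ≤
      (∫ y, Real.exp (-(c * ‖y‖ ^ 2)) * ‖x - y‖⁻¹) *
        ∫ y, Real.exp (c * ‖y‖ ^ 2) * g y ^ 2 * ‖x - y‖⁻¹ := by
  have hQc : Continuous fun y : EuclideanSpace ℝ (Fin 2) => Real.exp (c * ‖y‖ ^ 2) * g y ^ 2 := by
    fun_prop
  have hQs : HasCompactSupport fun y : EuclideanSpace ℝ (Fin 2) =>
      Real.exp (c * ‖y‖ ^ 2) * g y ^ 2 :=
    (hgc.comp_left (g := fun t : ℝ => t ^ 2) (by simp)).mul_left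
  obtain ⟨KQ, hKQ⟩ := hQc.bounded_above_of_compact_support hQs
  have hQi : Integrable fun y : EuclideanSpace ℝ (Fin 2) => Real.exp (c * ‖y‖ ^ 2) * g y ^ 2 :=
    hQc.integrable_of_hasCompactSupport hQs
  have hB := (integral_mul_inv_norm_sub_le hQi (fun y => by positivity)
    (fun y => (Real.le_norm_self _).trans (hKQ y)) x).1
  have hA := (integral_mul_inv_norm_sub_le (integrable_exp_neg_mul_norm_sq_two hc)
    (fun y => by positivity)
    (fun y => Real.exp_le_one_iff.2 (by nlinarith [sq_nonneg ‖y‖, hc])) x).1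
  have hmeas : Measurable fun y : EuclideanSpace ℝ (Fin 2) => ‖x - y‖⁻¹ :=
    (measurable_const.sub measurable_id).norm.inv
  have h := sq_integral_sqrt_mul_le (μ := volume)
    (A := fun y => Real.exp (-(c * ‖y‖ ^ 2)) * ‖x - y‖⁻¹)
    (B := fun y => Real.exp (c * ‖y‖ ^ 2) * g y ^ 2 * ‖x - y‖⁻¹)
    (fun y => by positivity) (fun y => by positivity)
    ((by fun_prop : Measurable fun y : EuclideanSpace ℝ (Fin 2) =>
      Real.exp (-(c * ‖y‖ ^ 2))).mul hmeas)
    (hQc.measurable.mul hmeas) hA hB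
  refine le_trans (le_of_eq ?_) h
  congr 1
  refine integral_congr_ae (Eventually.of_forall fun y => ?_)
  have hprod : Real.exp (-(c * ‖y‖ ^ 2)) * ‖x - y‖⁻¹ *
      (Real.exp (c * ‖y‖ ^ 2) * g y ^ 2 * ‖x - y‖⁻¹) = (|g y| * ‖x - y‖⁻¹) ^ 2 := by
    rw [mul_pow, sq_abs, Real.exp_neg]
    field_simp
  simp only [hprod, Real.sqrt_sq (mul_nonneg (abs_nonneg _) (inv_nonneg.2 (norm_nonneg _)))]

/-! ### Tonelli -/

/-- **Tonelli bound.** For continuous integrable `0 ≤ W ≤ K_W` and `0 ≤ Q ≤ K_Q`: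
`x ↦ W(x) ∫ Q(y)|x−y|⁻¹ dy` is integrable and
`∫ W(x) (∫ Q(y) |x−y|⁻¹ dy) dx ≤ (K_W ∫_{|z|<1}|z|⁻¹ + ∫ W) ∫ Q`. [folklore] -/
theorem integral_mul_integral_mul_inv_norm_le {W Q : EuclideanSpace ℝ (Fin 2) → ℝ} {KW KQ : ℝ}
    (hWc : Continuous W) (hWi : Integrable W) (hW0 : ∀ x, 0 ≤ W x) (hWK : ∀ x, W x ≤ KW)
    (hQc : Continuous Q) (hQi : Integrable Q) (hQ0 : ∀ y, 0 ≤ Q y) (hQK : ∀ y, Q y ≤ KQ) :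
    Integrable (fun x => W x * ∫ y, Q y * ‖x - y‖⁻¹) ∧
      ∫ x, W x * ∫ y, Q y * ‖x - y‖⁻¹ ≤
        (KW * (∫ z, indicator (ball (0 : EuclideanSpace ℝ (Fin 2)) 1) (fun z => ‖z‖⁻¹) z) +
          ∫ x, W x) * ∫ y, Q y := by
  set I₀ := ∫ z, indicator (ball (0 : EuclideanSpace ℝ (Fin 2)) 1) (fun z => ‖z‖⁻¹) z with hI₀
  set f : EuclideanSpace ℝ (Fin 2) → EuclideanSpace ℝ (Fin 2) → ℝ :=
    fun x y => W x * (Q y * ‖x - y‖⁻¹) with hf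
  have hFm : AEStronglyMeasurable (uncurry f) (volume.prod volume) := by
    refine Measurable.aestronglyMeasurable ?_
    exact (hWc.measurable.comp measurable_fst).mul ((hQc.measurable.comp measurable_snd).mul
      ((measurable_fst.sub measurable_snd).norm.inv))
  have hnn : ∀ x y, 0 ≤ f x y := fun x y =>
    mul_nonneg (hW0 x) (mul_nonneg (hQ0 y) (inv_nonneg.2 (norm_nonneg _)))
  have hrow : ∀ x, Integrable (f x) := fun x =>
    (integral_mul_inv_norm_sub_le hQi hQ0 hQK x).1.const_mul (W x)
  have hrow_eq : ∀ x, ∫ y, f x y = W x * ∫ y, Q y * ‖x - y‖⁻¹ := fun x => by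
    simp only [hf]; rw [integral_const_mul]
  have hrow_norm : ∀ x, ∫ y, ‖uncurry f (x, y)‖ = W x * ∫ y, Q y * ‖x - y‖⁻¹ := by
    intro x
    rw [← hrow_eq]
    refine integral_congr_ae (Eventually.of_forall fun y => ?_)
    simp only [uncurry_apply_pair, Real.norm_of_nonneg (hnn x y)]
  have hMQ : ∀ x, ∫ y, Q y * ‖x - y‖⁻¹ ≤ KQ * I₀ + ∫ y, Q y := fun x =>
    (integral_mul_inv_norm_sub_le hQi hQ0 hQK x).2
  have hP0 : ∀ x, 0 ≤ ∫ y, Q y * ‖x - y‖⁻¹ := fun x =>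
    integral_nonneg fun y => mul_nonneg (hQ0 y) (inv_nonneg.2 (norm_nonneg _))
  have hnormrow : Integrable (fun x => ∫ y, ‖uncurry f (x, y)‖) := by
    refine (hWi.mul_const (KQ * I₀ + ∫ y, Q y)).mono' hFm.norm.integral_prod_right'
      (Eventually.of_forall fun x => ?_)
    rw [hrow_norm, Real.norm_of_nonneg (mul_nonneg (hW0 x) (hP0 x))]
    exact mul_le_mul_of_nonneg_left (hMQ x) (hW0 x)
  have hInt : Integrable (uncurry f) (volume.prod volume) :=
    (integrable_prod_iff hFm).2 ⟨Eventually.of_forall hrow, hnormrow⟩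
  refine ⟨hInt.integral_prod_left.congr (Eventually.of_forall hrow_eq), ?_⟩
  have hswap := integral_integral_swap hInt
  have hMW : ∀ y, ∫ x, W x * ‖x - y‖⁻¹ ≤ KW * I₀ + ∫ x, W x := fun y =>
    (integral_mul_inv_norm_sub_le' hWi hW0 hWK y).2
  calc ∫ x, W x * ∫ y, Q y * ‖x - y‖⁻¹ = ∫ x, ∫ y, f x y :=
        integral_congr_ae (Eventually.of_forall fun x => (hrow_eq x).symm)
    _ = ∫ y, ∫ x, f x y := hswap
    _ ≤ ∫ y, Q y * (KW * I₀ + ∫ x, W x) := by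
        refine integral_mono hInt.integral_prod_right (hQi.mul_const _) fun y => ?_
        simp only [hf]
        calc ∫ x, W x * (Q y * ‖x - y‖⁻¹) = Q y * ∫ x, W x * ‖x - y‖⁻¹ := by
              rw [← integral_const_mul]
              exact integral_congr_ae (Eventually.of_forall fun x => by ring)
          _ ≤ Q y * (KW * I₀ + ∫ x, W x) := mul_le_mul_of_nonneg_left (hMW y) (hQ0 y)
    _ = (KW * I₀ + ∫ x, W x) * ∫ y, Q y := by rw [integral_mul_const, mul_comm]

/-! ### The weighted bounds -/

/-- Common data of a weight `0 ≤ W ≤ K e^{−β|x|²}`: `K ≥ 0`, `W ≤ K`, `W` and `|x|² W` integrable.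
[folklore] -/
theorem gaussWeight_aux {W : EuclideanSpace ℝ (Fin 2) → ℝ} {K β : ℝ} (hWc : Continuous W)
    (hW0 : ∀ x, 0 ≤ W x) (hWK : ∀ x, W x ≤ K * Real.exp (-(β * ‖x‖ ^ 2))) (hβ : 0 < β) :
    0 ≤ K ∧ (∀ x, W x ≤ K) ∧ Integrable W ∧ Integrable fun x => W x * ‖x‖ ^ 2 := by
  have hK0 : 0 ≤ K := by have := (hW0 0).trans (hWK 0); simpa using this
  have hexp1 : ∀ x : EuclideanSpace ℝ (Fin 2), Real.exp (-(β * ‖x‖ ^ 2)) ≤ 1 := fun x =>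
    Real.exp_le_one_iff.2 (by nlinarith [sq_nonneg ‖x‖, hβ])
  refine ⟨hK0, fun x => (hWK x).trans (mul_le_of_le_one_right hK0 (hexp1 x)), ?_, ?_⟩
  · refine ((integrable_exp_neg_mul_norm_sq_two hβ).const_mul K).mono' hWc.aestronglyMeasurable
      (Eventually.of_forall fun x => ?_)
    rw [Real.norm_of_nonneg (hW0 x)]; exact hWK x
  · refine ((integrable_norm_sq_mul_exp_neg_mul_norm_sq_two hβ).const_mul K).mono'
      (by fun_prop) (Eventually.of_forall fun x => ?_)
    rw [Real.norm_of_nonneg (mul_nonneg (hW0 x) (sq_nonneg _))]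
    calc W x * ‖x‖ ^ 2 ≤ K * Real.exp (-(β * ‖x‖ ^ 2)) * ‖x‖ ^ 2 := by gcongr; exact hWK x
      _ = K * (‖x‖ ^ 2 * Real.exp (-(β * ‖x‖ ^ 2))) := by ring

/-- Common data of the density `Q = e^{c|y|²} g²` of a continuous compactly supported `g`.
[folklore] -/
theorem gaussDensity_aux {g : EuclideanSpace ℝ (Fin 2) → ℝ} (hg : Continuous g)
    (hgc : HasCompactSupport g) (c : ℝ) :
    Continuous (fun y : EuclideanSpace ℝ (Fin 2) => Real.exp (c * ‖y‖ ^ 2) * g y ^ 2) ∧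
    Integrable (fun y : EuclideanSpace ℝ (Fin 2) => Real.exp (c * ‖y‖ ^ 2) * g y ^ 2) ∧
    ∃ KQ, ∀ y : EuclideanSpace ℝ (Fin 2), Real.exp (c * ‖y‖ ^ 2) * g y ^ 2 ≤ KQ := by
  have hQc : Continuous fun y : EuclideanSpace ℝ (Fin 2) => Real.exp (c * ‖y‖ ^ 2) * g y ^ 2 := by
    fun_prop
  have hQs : HasCompactSupport fun y : EuclideanSpace ℝ (Fin 2) =>
      Real.exp (c * ‖y‖ ^ 2) * g y ^ 2 :=
    (hgc.comp_left (g := fun t : ℝ => t ^ 2) (by simp)).mul_left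
  obtain ⟨KQ, hKQ⟩ := hQc.bounded_above_of_compact_support hQs
  exact ⟨hQc, hQc.integrable_of_hasCompactSupport hQs, KQ,
    fun y => (Real.le_norm_self _).trans (hKQ y)⟩

/-- **Gaussian-weighted `L²` bound for the Biot–Savart velocity.** For a continuous weight
`0 ≤ W ≤ K e^{−β|x|²}` (`β > 0`) and `c > 0` there is `C = C(W, c)` such that for every continuous
compactly supported vorticity `g`, `W |K_{2D} ∗ g|²` is integrable and
`∫ W |K_{2D} ∗ g|² ≤ C ∫ e^{c|y|²} g(y)² dy`. [folklore] -/
theorem exists_integral_mul_norm_sq_biotSavart2D_le {W : EuclideanSpace ℝ (Fin 2) → ℝ} {K β : ℝ}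
    (hWc : Continuous W) (hW0 : ∀ x, 0 ≤ W x) (hWK : ∀ x, W x ≤ K * Real.exp (-(β * ‖x‖ ^ 2)))
    (hβ : 0 < β) {c : ℝ} (hc : 0 < c) :
    ∃ C, 0 ≤ C ∧ ∀ g : EuclideanSpace ℝ (Fin 2) → ℝ, Continuous g → HasCompactSupport g →
      Integrable (fun x => W x * ‖biotSavart2D g x‖ ^ 2) ∧
      ∫ x, W x * ‖biotSavart2D g x‖ ^ 2 ≤ C * ∫ y, Real.exp (c * ‖y‖ ^ 2) * g y ^ 2 := by
  obtain ⟨hK0, hWK', hWi, -⟩ := gaussWeight_aux hWc hW0 hWK hβ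
  set I₀ := ∫ z, indicator (ball (0 : EuclideanSpace ℝ (Fin 2)) 1) (fun z => ‖z‖⁻¹) z with hI₀
  have hI₀ : 0 ≤ I₀ := integral_indicator_inv_norm_nonneg
  set CA := 1 * I₀ + ∫ y : EuclideanSpace ℝ (Fin 2), Real.exp (-(c * ‖y‖ ^ 2)) with hCA
  have hCA0 : 0 ≤ CA := add_nonneg (by simpa using hI₀) (integral_nonneg fun _ => (Real.exp_pos _).le)
  set MW := K * I₀ + ∫ x, W x with hMW
  have hMW0 : 0 ≤ MW := add_nonneg (mul_nonneg hK0 hI₀) (integral_nonneg hW0)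
  refine ⟨(2 * Real.pi)⁻¹ ^ 2 * CA * MW, by positivity, fun g hg hgc => ?_⟩
  obtain ⟨hQc, hQi, KQ, hQK⟩ := gaussDensity_aux hg hgc c
  have hQ0 : ∀ y : EuclideanSpace ℝ (Fin 2), 0 ≤ Real.exp (c * ‖y‖ ^ 2) * g y ^ 2 := fun y => by
    positivity
  obtain ⟨hTi, hT⟩ := integral_mul_integral_mul_inv_norm_le hWc hWi hW0 hWK' hQc hQi hQ0 hQK
  -- `sup_x ∫ e^{-c|y|²}|x-y|⁻¹ dy ≤ CA`
  have hA : ∀ x, ∫ y, Real.exp (-(c * ‖y‖ ^ 2)) * ‖x - y‖⁻¹ ≤ CA := fun x =>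
    (integral_mul_inv_norm_sub_le (integrable_exp_neg_mul_norm_sq_two hc) (fun y => by positivity)
      (fun y => Real.exp_le_one_iff.2 (by nlinarith [sq_nonneg ‖y‖, hc])) x).2
  -- pointwise bound
  have hpt : ∀ x, W x * ‖biotSavart2D g x‖ ^ 2 ≤ (2 * Real.pi)⁻¹ ^ 2 * CA *
      (W x * ∫ y, Real.exp (c * ‖y‖ ^ 2) * g y ^ 2 * ‖x - y‖⁻¹) := by
    intro x
    have h1 := norm_biotSavart2D_le_integral g x
    have h2 := sq_integral_abs_mul_inv_norm_le hg hgc hc x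
    have hP0 : 0 ≤ ∫ y, |g y| * ‖x - y‖⁻¹ :=
      integral_nonneg fun y => mul_nonneg (abs_nonneg _) (inv_nonneg.2 (norm_nonneg _))
    have hB0 : 0 ≤ ∫ y, Real.exp (c * ‖y‖ ^ 2) * g y ^ 2 * ‖x - y‖⁻¹ :=
      integral_nonneg fun y => mul_nonneg (hQ0 y) (inv_nonneg.2 (norm_nonneg _))
    have h3 : ‖biotSavart2D g x‖ ^ 2 ≤ (2 * Real.pi)⁻¹ ^ 2 * (∫ y, |g y| * ‖x - y‖⁻¹) ^ 2 := by
      rw [← mul_pow]; exact pow_le_pow_left₀ (norm_nonneg _) h1 2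
    have h4 : (∫ y, |g y| * ‖x - y‖⁻¹) ^ 2 ≤
        CA * ∫ y, Real.exp (c * ‖y‖ ^ 2) * g y ^ 2 * ‖x - y‖⁻¹ :=
      h2.trans (mul_le_mul_of_nonneg_right (hA x) hB0)
    calc W x * ‖biotSavart2D g x‖ ^ 2
        ≤ W x * ((2 * Real.pi)⁻¹ ^ 2 * (CA * ∫ y, Real.exp (c * ‖y‖ ^ 2) * g y ^ 2 * ‖x - y‖⁻¹)) :=
          mul_le_mul_of_nonneg_left (h3.trans (mul_le_mul_of_nonneg_left h4 (by positivity))) (hW0 x)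
      _ = _ := by ring
  have hvc : Continuous fun x => W x * ‖biotSavart2D g x‖ ^ 2 :=
    hWc.mul ((contDiff_biotSavart2D (n := 0) (contDiff_zero.2 hg) hgc).continuous.norm.pow 2)
  have hint : Integrable fun x => W x * ‖biotSavart2D g x‖ ^ 2 :=
    (hTi.const_mul ((2 * Real.pi)⁻¹ ^ 2 * CA)).mono' hvc.aestronglyMeasurable
      (Eventually.of_forall fun x => by
        rw [Real.norm_of_nonneg (mul_nonneg (hW0 x) (sq_nonneg _))]; exact hpt x)
  refine ⟨hint, ?_⟩
  calc ∫ x, W x * ‖biotSavart2D g x‖ ^ 2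
      ≤ ∫ x, (2 * Real.pi)⁻¹ ^ 2 * CA *
          (W x * ∫ y, Real.exp (c * ‖y‖ ^ 2) * g y ^ 2 * ‖x - y‖⁻¹) :=
        integral_mono hint (hTi.const_mul _) hpt
    _ = (2 * Real.pi)⁻¹ ^ 2 * CA * ∫ x, W x * ∫ y, Real.exp (c * ‖y‖ ^ 2) * g y ^ 2 * ‖x - y‖⁻¹ :=
        integral_const_mul _ _
    _ ≤ (2 * Real.pi)⁻¹ ^ 2 * CA * (MW * ∫ y, Real.exp (c * ‖y‖ ^ 2) * g y ^ 2) :=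
        mul_le_mul_of_nonneg_left hT (by positivity)
    _ = (2 * Real.pi)⁻¹ ^ 2 * CA * MW * ∫ y, Real.exp (c * ‖y‖ ^ 2) * g y ^ 2 := by ring

/-- **Gaussian-weighted `L²` bound for the logarithmic potential.** For a continuous weight
`0 ≤ W ≤ K e^{−β|x|²}` (`β > 0`) and `c > 0` there is `C = C(W, c)` such that for every continuous
compactly supported vorticity `g`, `W (N ∗ g)²` is integrable and
`∫ W (N ∗ g)² ≤ C ∫ e^{c|y|²} g(y)² dy`. [folklore] -/
theorem exists_integral_mul_sq_logPotential_le {W : EuclideanSpace ℝ (Fin 2) → ℝ} {K β : ℝ}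
    (hWc : Continuous W) (hW0 : ∀ x, 0 ≤ W x) (hWK : ∀ x, W x ≤ K * Real.exp (-(β * ‖x‖ ^ 2)))
    (hβ : 0 < β) {c : ℝ} (hc : 0 < c) :
    ∃ C, 0 ≤ C ∧ ∀ g : EuclideanSpace ℝ (Fin 2) → ℝ, Continuous g → HasCompactSupport g →
      Integrable (fun x => W x * (∫ y, g y * ((2 * Real.pi)⁻¹ * Real.log ‖x - y‖)) ^ 2) ∧
      ∫ x, W x * (∫ y, g y * ((2 * Real.pi)⁻¹ * Real.log ‖x - y‖)) ^ 2 ≤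
        C * ∫ y, Real.exp (c * ‖y‖ ^ 2) * g y ^ 2 := by
  obtain ⟨hK0, hWK', hWi, hWi2⟩ := gaussWeight_aux hWc hW0 hWK hβ
  set I₀ := ∫ z, indicator (ball (0 : EuclideanSpace ℝ (Fin 2)) 1) (fun z => ‖z‖⁻¹) z with hI₀
  have hI₀ : 0 ≤ I₀ := integral_indicator_inv_norm_nonneg
  set CA := 1 * I₀ + ∫ y : EuclideanSpace ℝ (Fin 2), Real.exp (-(c * ‖y‖ ^ 2)) with hCA
  have hCA0 : 0 ≤ CA := add_nonneg (by simpa using hI₀) (integral_nonneg fun _ => (Real.exp_pos _).le)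
  set MW := K * I₀ + ∫ x, W x with hMW
  have hMW0 : 0 ≤ MW := add_nonneg (mul_nonneg hK0 hI₀) (integral_nonneg hW0)
  set G₀ := ∫ y : EuclideanSpace ℝ (Fin 2), Real.exp (-(c * ‖y‖ ^ 2)) with hG₀
  have hG₀0 : 0 ≤ G₀ := integral_nonneg fun _ => (Real.exp_pos _).le
  set G₂ := ∫ y : EuclideanSpace ℝ (Fin 2), ‖y‖ ^ 2 * Real.exp (-(c * ‖y‖ ^ 2)) with hG₂
  have hG₂0 : 0 ≤ G₂ := integral_nonneg fun _ => by positivity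
  set M₁ := ∫ x, W x with hM₁
  have hM₁0 : 0 ≤ M₁ := integral_nonneg hW0
  set M₂ := ∫ x, W x * ‖x‖ ^ 2 with hM₂
  have hM₂0 : 0 ≤ M₂ := integral_nonneg fun x => mul_nonneg (hW0 x) (sq_nonneg _)
  refine ⟨3 * (2 * Real.pi)⁻¹ ^ 2 * (CA * MW + G₀ * M₂ + G₂ * M₁), by positivity,
    fun g hg hgc => ?_⟩
  obtain ⟨hQc, hQi, KQ, hQK⟩ := gaussDensity_aux hg hgc c
  have hQ0 : ∀ y : EuclideanSpace ℝ (Fin 2), 0 ≤ Real.exp (c * ‖y‖ ^ 2) * g y ^ 2 := fun y => by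
    positivity
  set NQ := ∫ y, Real.exp (c * ‖y‖ ^ 2) * g y ^ 2 with hNQ
  have hNQ0 : 0 ≤ NQ := integral_nonneg hQ0
  obtain ⟨hTi, hT⟩ := integral_mul_integral_mul_inv_norm_le hWc hWi hW0 hWK' hQc hQi hQ0 hQK
  have hA : ∀ x, ∫ y, Real.exp (-(c * ‖y‖ ^ 2)) * ‖x - y‖⁻¹ ≤ CA := fun x =>
    (integral_mul_inv_norm_sub_le (integrable_exp_neg_mul_norm_sq_two hc) (fun y => by positivity)
      (fun y => Real.exp_le_one_iff.2 (by nlinarith [sq_nonneg ‖y‖, hc])) x).2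
  -- the two global Cauchy–Schwarz bounds `N₀² ≤ G₀ NQ`, `N₁² ≤ G₂ NQ`
  have hexpm : Measurable fun y : EuclideanSpace ℝ (Fin 2) => Real.exp (-(c * ‖y‖ ^ 2)) := by
    fun_prop
  have hN₀ : (∫ y, |g y|) ^ 2 ≤ G₀ * NQ := by
    have h := sq_integral_sqrt_mul_le (μ := volume)
      (A := fun y : EuclideanSpace ℝ (Fin 2) => Real.exp (-(c * ‖y‖ ^ 2)))
      (B := fun y => Real.exp (c * ‖y‖ ^ 2) * g y ^ 2)
      (fun y => by positivity) hQ0 hexpm hQc.measurable (integrable_exp_neg_mul_norm_sq_two hc) hQi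
    refine le_trans (le_of_eq ?_) h
    congr 1
    refine integral_congr_ae (Eventually.of_forall fun y => ?_)
    have : Real.exp (-(c * ‖y‖ ^ 2)) * (Real.exp (c * ‖y‖ ^ 2) * g y ^ 2) = |g y| ^ 2 := by
      rw [sq_abs, Real.exp_neg]; field_simp
    simp only [this, Real.sqrt_sq (abs_nonneg _)]
  have hN₁ : (∫ y, ‖y‖ * |g y|) ^ 2 ≤ G₂ * NQ := by
    have h := sq_integral_sqrt_mul_le (μ := volume)
      (A := fun y : EuclideanSpace ℝ (Fin 2) => ‖y‖ ^ 2 * Real.exp (-(c * ‖y‖ ^ 2)))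
      (B := fun y => Real.exp (c * ‖y‖ ^ 2) * g y ^ 2)
      (fun y => by positivity) hQ0 (by fun_prop) hQc.measurable
      (integrable_norm_sq_mul_exp_neg_mul_norm_sq_two hc) hQi
    refine le_trans (le_of_eq ?_) h
    congr 1
    refine integral_congr_ae (Eventually.of_forall fun y => ?_)
    have : ‖y‖ ^ 2 * Real.exp (-(c * ‖y‖ ^ 2)) * (Real.exp (c * ‖y‖ ^ 2) * g y ^ 2) =
        (‖y‖ * |g y|) ^ 2 := by
      rw [mul_pow, sq_abs, Real.exp_neg]; field_simp
    simp only [this, Real.sqrt_sq (mul_nonneg (norm_nonneg _) (abs_nonneg _))]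
  -- pointwise bound on `W ψ²`
  have hpt : ∀ x, W x * (∫ y, g y * ((2 * Real.pi)⁻¹ * Real.log ‖x - y‖)) ^ 2 ≤
      3 * (2 * Real.pi)⁻¹ ^ 2 * (CA * (W x * ∫ y, Real.exp (c * ‖y‖ ^ 2) * g y ^ 2 * ‖x - y‖⁻¹) +
        G₀ * NQ * (W x * ‖x‖ ^ 2) + G₂ * NQ * W x) := by
    intro x
    have h1 := abs_logPotential_le_integral hg hgc x
    have h2 := sq_integral_abs_mul_inv_norm_le hg hgc hc x
    set P := ∫ y, |g y| * ‖x - y‖⁻¹ with hP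
    have hP0 : 0 ≤ P := integral_nonneg fun y => mul_nonneg (abs_nonneg _) (inv_nonneg.2 (norm_nonneg _))
    have hB0 : 0 ≤ ∫ y, Real.exp (c * ‖y‖ ^ 2) * g y ^ 2 * ‖x - y‖⁻¹ :=
      integral_nonneg fun y => mul_nonneg (hQ0 y) (inv_nonneg.2 (norm_nonneg _))
    have h4 : P ^ 2 ≤ CA * ∫ y, Real.exp (c * ‖y‖ ^ 2) * g y ^ 2 * ‖x - y‖⁻¹ :=
      h2.trans (mul_le_mul_of_nonneg_right (hA x) hB0)
    set N₀ := ∫ y, |g y| with hN0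
    set N₁ := ∫ y, ‖y‖ * |g y| with hN1
    have hN00 : 0 ≤ N₀ := integral_nonneg fun _ => abs_nonneg _
    have hN10 : 0 ≤ N₁ := integral_nonneg fun _ => mul_nonneg (norm_nonneg _) (abs_nonneg _)
    have hsq : (∫ y, g y * ((2 * Real.pi)⁻¹ * Real.log ‖x - y‖)) ^ 2 ≤
        ((2 * Real.pi)⁻¹ * (P + ‖x‖ * N₀ + N₁)) ^ 2 := by
      rw [← sq_abs]
      exact pow_le_pow_left₀ (abs_nonneg _) h1 2
    have h3sq : (P + ‖x‖ * N₀ + N₁) ^ 2 ≤ 3 * (P ^ 2 + ‖x‖ ^ 2 * N₀ ^ 2 + N₁ ^ 2) := by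
      nlinarith [sq_nonneg (P - ‖x‖ * N₀), sq_nonneg (P - N₁), sq_nonneg (‖x‖ * N₀ - N₁)]
    have hx0 : 0 ≤ ‖x‖ ^ 2 := sq_nonneg _
    calc W x * (∫ y, g y * ((2 * Real.pi)⁻¹ * Real.log ‖x - y‖)) ^ 2
        ≤ W x * ((2 * Real.pi)⁻¹ ^ 2 * (3 * (P ^ 2 + ‖x‖ ^ 2 * N₀ ^ 2 + N₁ ^ 2))) := by
          refine mul_le_mul_of_nonneg_left (hsq.trans ?_) (hW0 x)
          rw [mul_pow]
          exact mul_le_mul_of_nonneg_left h3sq (by positivity)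
      _ ≤ W x * ((2 * Real.pi)⁻¹ ^ 2 * (3 * (CA * (∫ y, Real.exp (c * ‖y‖ ^ 2) * g y ^ 2 *
            ‖x - y‖⁻¹) + ‖x‖ ^ 2 * (G₀ * NQ) + G₂ * NQ))) := by
          gcongr
          · exact hW0 x
      _ = _ := by ring
  have hψc : Continuous fun x => W x * (∫ y, g y * ((2 * Real.pi)⁻¹ * Real.log ‖x - y‖)) ^ 2 :=
    hWc.mul ((contDiff_logPotential (n := 0) (contDiff_zero.2 hg) hgc).continuous.pow 2)
  have hmaj : Integrable fun x => 3 * (2 * Real.pi)⁻¹ ^ 2 *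
      (CA * (W x * ∫ y, Real.exp (c * ‖y‖ ^ 2) * g y ^ 2 * ‖x - y‖⁻¹) +
        G₀ * NQ * (W x * ‖x‖ ^ 2) + G₂ * NQ * W x) :=
    (((hTi.const_mul CA).add (hWi2.const_mul _)).add (hWi.const_mul _)).const_mul _
  have hint : Integrable fun x => W x * (∫ y, g y * ((2 * Real.pi)⁻¹ * Real.log ‖x - y‖)) ^ 2 :=
    hmaj.mono' hψc.aestronglyMeasurable (Eventually.of_forall fun x => by
      rw [Real.norm_of_nonneg (mul_nonneg (hW0 x) (sq_nonneg _))]; exact hpt x)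
  refine ⟨hint, ?_⟩
  calc ∫ x, W x * (∫ y, g y * ((2 * Real.pi)⁻¹ * Real.log ‖x - y‖)) ^ 2
      ≤ ∫ x, 3 * (2 * Real.pi)⁻¹ ^ 2 *
          (CA * (W x * ∫ y, Real.exp (c * ‖y‖ ^ 2) * g y ^ 2 * ‖x - y‖⁻¹) +
            G₀ * NQ * (W x * ‖x‖ ^ 2) + G₂ * NQ * W x) := integral_mono hint hmaj hpt
    _ = 3 * (2 * Real.pi)⁻¹ ^ 2 * (CA * (∫ x, W x * ∫ y, Real.exp (c * ‖y‖ ^ 2) * g y ^ 2 *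
          ‖x - y‖⁻¹) + G₀ * NQ * M₂ + G₂ * NQ * M₁) := by
        have i1 : Integrable fun x => CA * (W x * ∫ y, Real.exp (c * ‖y‖ ^ 2) * g y ^ 2 *
            ‖x - y‖⁻¹) := hTi.const_mul CA
        have i2 : Integrable fun x => G₀ * NQ * (W x * ‖x‖ ^ 2) := hWi2.const_mul _
        have i3 : Integrable fun x => G₂ * NQ * W x := hWi.const_mul _
        have i12 : Integrable fun x => CA * (W x * ∫ y, Real.exp (c * ‖y‖ ^ 2) * g y ^ 2 *
            ‖x - y‖⁻¹) + G₀ * NQ * (W x * ‖x‖ ^ 2) := i1.add i2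
        rw [integral_const_mul, integral_add i12 i3, integral_add i1 i2,
          integral_const_mul, integral_const_mul, integral_const_mul]
    _ ≤ 3 * (2 * Real.pi)⁻¹ ^ 2 * (CA * (MW * NQ) + G₀ * NQ * M₂ + G₂ * NQ * M₁) := by
        gcongr
    _ = 3 * (2 * Real.pi)⁻¹ ^ 2 * (CA * MW + G₀ * M₂ + G₂ * M₁) * NQ := by ring

end Literature.Analysis.FluidPDE
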